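import Summits.AnomalousDissipation.AnomalousDissipation.Theorems.SawtoothPulseCascadeApproxLipPieces
import Summits.AnomalousDissipation.AnomalousDissipation.Theorems.SawtoothPulseCascadeApproxRealignLip
import Summits.AnomalousDissipation.AnomalousDissipation.Theorems.SawtoothPulseCascadeApproxAssembly

/-!
# Lipschitz assembly at a fixed admissible viscosity: realigned data with Lipschitz sizes, pieces, and the
# Lipschitz phase envelope
(route `AnomalousDissipation/SawtoothPulseCascade`; helper for the crux ApproxSol58 =
stmt-AnomalousDissipation-19688, S2 `stub_responseLipEnvelope` of the lead's reshaped line `linear-response-lip`)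

The Lipschitz twin of `…ApproxAssembly.response_envelope_of_budget`.  For a parameter point `P` (`δ₀ > 0`, `d > 0`,
`γ ≥ 0`, `N_j ≠ 0`), a viscosity `ν > 0` satisfying the budget `16π²ν N_j² tHalf_j ≤ δ_j²` for the phases `j ≤ J`,
and the per-phase LIPSCHITZ cap at `ν` with factor `G ≥ 0` (the body of `K2LipschitzGrowthClassical P G` at `ν`), every
classical forced linearised response `(L, q)` on `[0, T'] ⊇ [0, tStart (J+1)]` from zero obeys, on slot `k` (phase
`k/2 ≤ J`), at every point `x` and in every direction `i`:

`‖∂ᵢ L(t)(x)‖ ≤ Σ_{l<k} G^{k/2+1−l/2} · (48π√(2π) + 12√π) ν γ (N_{l/2}/δ_{l/2})² + 24π√(2π) ν γ (N_{k/2}/δ_{k/2})²`.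

The realigned comb profiles WITH Lipschitz sizes come from `exists_realigned_lip_H/V` (`…ApproxRealignLip`; under
the halved budget `δ'_j ≥ δ_j/√2`, so `|g| ≤ 12√π νγ N_j/δ_j`, `|g'| ≤ 48π√(2π) νγ N_j²/δ_j²`), the pieces from the tree's
`Torus.linearisedNS_exists`, the envelope from `response_phase_lip_envelope`.
-/

set_option linter.dupNamespace false

noncomputable section

namespace Summit.AnomalousDissipation.AnomalousDissipation.Theorems.SawtoothPulseCascade.ApproxResponse

open Set MeasureTheory UnitAddTorus
open scoped ContDiff InnerProductSpace
open Literature.Analysis Literature.Analysis.FunctionSpaces Literature.Analysis.FluidPDE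
open Literature.Analysis.FluidPDE.SawtoothCascade
open Literature.Analysis.FluidPDE.SawtoothCascade.CascadeParams
open Summit.AnomalousDissipation.AnomalousDissipation.Theorems.SawtoothPulseCascade.K2Classical

/-- Under the (non-strict, halved) budget `16π²νN²τ ≤ δ²` with `ν, τ > 0`: `1/δ'² ≤ 2/δ²` for the sharper width
`δ'² = δ² − 8π²νN²τ`. -/
theorem budget_facts_sq {δ ν τ : ℝ} {N : ℕ} (hδ : 0 < δ) (hν : 0 < ν) (hτ : 0 < τ) (hN : N ≠ 0)
    (hbud : 16 * Real.pi ^ 2 * ν * (N : ℝ) ^ 2 * τ ≤ δ ^ 2) :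
    1 / (δ ^ 2 - 8 * Real.pi ^ 2 * ν * (N : ℝ) ^ 2 * τ) ≤ 2 / δ ^ 2 := by
  have hN' : (0 : ℝ) < N := Nat.cast_pos.2 (Nat.pos_of_ne_zero hN)
  have hpos : 0 < 8 * Real.pi ^ 2 * ν * (N : ℝ) ^ 2 * τ := by positivity
  have hge : δ ^ 2 / 2 ≤ δ ^ 2 - 8 * Real.pi ^ 2 * ν * (N : ℝ) ^ 2 * τ := by linarith
  have hd : 0 < δ ^ 2 / 2 := by positivity
  calc 1 / (δ ^ 2 - 8 * Real.pi ^ 2 * ν * (N : ℝ) ^ 2 * τ) ≤ 1 / (δ ^ 2 / 2) := one_div_le_one_div_of_le hd hge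
    _ = 2 / δ ^ 2 := by field_simp

section Assembly

variable (P : CascadeParams) {ν G T' : ℝ} {J : ℕ}

/-- **The Lipschitz phase envelope at an admissible viscosity.**  See the module docstring. -/
theorem response_lip_envelope_of_budget (hδ₀ : 0 < P.δ₀) (hd : 0 < P.d) (hγ : 0 ≤ P.γ) (hN : ∀ j, P.N j ≠ 0)
    (hν : 0 < ν) (hG : 0 ≤ G)
    (hLipν : ∀ (j₀ J : ℕ), j₀ ≤ J → ∀ (hz : Bool)
      (w₀ : UnitAddTorus (Fin 2) → EuclideanSpace ℝ (Fin 2))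
      (w : ℝ → UnitAddTorus (Fin 2) → EuclideanSpace ℝ (Fin 2)) (q : ℝ → UnitAddTorus (Fin 2) → ℝ),
      ShearCombDatum (P.N j₀) hz w₀ →
      Torus.IsSmoothSpaceTimeOn (Icc (CascadeParams.tInject j₀ hz) (CascadeParams.tStart (J + 1))) w →
      Torus.IsSmoothSpaceTimeOn (Icc (CascadeParams.tInject j₀ hz) (CascadeParams.tStart (J + 1))) q →
      (∀ t ∈ Icc (CascadeParams.tInject j₀ hz) (CascadeParams.tStart (J + 1)), Torus.IsDivFree (w t)) →
      (∀ t ∈ Icc (CascadeParams.tInject j₀ hz) (CascadeParams.tStart (J + 1)), ∀ x,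
        Torus.timeDerivWithin (Icc (CascadeParams.tInject j₀ hz) (CascadeParams.tStart (J + 1))) w t x +
          Torus.convect (P.field t) (w t) x + Torus.convect (w t) (P.field t) x =
          ν • Torus.laplacian (w t) x - Torus.gradient (q t) x) →
      w (CascadeParams.tInject j₀ hz) = w₀ →
      ∀ (D₀ D₁ : ℝ), (∀ x, ‖w₀ x‖ ≤ D₀) → (∀ x, ‖Torus.fderiv w₀ x‖ ≤ D₁) →
      ∀ t ∈ Icc (max (CascadeParams.tInject j₀ hz) (CascadeParams.tStart J)) (CascadeParams.tStart (J + 1)), ∀ x,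
        ‖Torus.fderiv (w t) x‖ ≤ G ^ (J + 1 - j₀) * (D₁ + (P.N j₀ : ℝ) / P.δ j₀ * D₀))
    (hbud : ∀ j ≤ J, 16 * Real.pi ^ 2 * ν * (P.N j : ℝ) ^ 2 * tHalf j ≤ P.δ j ^ 2)
    (hJT : tStart (J + 1) ≤ T') (hT'1 : T' < 1)
    {L : ℝ → UnitAddTorus (Fin 2) → EuclideanSpace ℝ (Fin 2)} {q : ℝ → UnitAddTorus (Fin 2) → ℝ}
    (hL : Torus.IsSmoothSpaceTimeOn (Icc 0 T') L) (hq : Torus.IsSmoothSpaceTimeOn (Icc 0 T') q)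
    (hLdiv : ∀ t ∈ Icc 0 T', Torus.IsDivFree (L t)) (hL0 : L 0 = fun _ => 0)
    (hlin : ∀ t ∈ Icc 0 T', ∀ x, Torus.timeDerivWithin (Icc 0 T') L t x + Torus.convect (P.field t) (L t) x +
      Torus.convect (L t) (P.field t) x =
        ν • Torus.laplacian (L t) x - Torus.gradient (q t) x + ν • Torus.laplacian (P.field t) x)
    {k : ℕ} (hk : k < 2 * (J + 1)) {t : ℝ}
    (ht : t ∈ Icc (CascadeParams.tInject (k / 2) (k % 2 == 0)) (CascadeParams.tInject ((k + 1) / 2) ((k + 1) % 2 == 0)))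
    (x : UnitAddTorus (Fin 2)) (i : Fin 2) :
    ‖Torus.partialDeriv i (L t) x‖ ≤
      ∑ l ∈ Finset.range k, G ^ (k / 2 + 1 - l / 2) *
          ((48 * Real.pi * Real.sqrt (2 * Real.pi) + 12 * Real.sqrt Real.pi) * ν * P.γ *
            ((P.N (l / 2) : ℝ) / P.δ (l / 2)) ^ 2) +
        24 * Real.pi * Real.sqrt (2 * Real.pi) * ν * P.γ * ((P.N (k / 2) : ℝ) / P.δ (k / 2)) ^ 2 := by
  have hδ : ∀ j, 0 < P.δ j := fun j => P.δ_pos hδ₀ hd j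
  have hbud' : ∀ j ≤ J, 8 * Real.pi ^ 2 * ν * (P.N j : ℝ) ^ 2 * tHalf j < P.δ j ^ 2 :=
    fun j hj => (budget_facts (hδ j) hν (tHalf_pos j) (hN j) (hbud j hj)).1
  -- Step 1: the realigned comb profiles with Lipschitz sizes, phase by phase (H and V)
  have hexH : ∀ j : ℕ, ∃ g : ℝ → ℝ, j ≤ J → (ContDiff ℝ ∞ g ∧ Function.Periodic g 1 ∧
      (∀ m : ℤ, (¬ ∃ n : ℤ, m = (2 * n + 1) * (P.N j : ℤ)) →
        fourierCoeff (AddCircle.liftIco 1 0 fun y => (g y : ℂ)) m = 0) ∧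
      (∀ y, |g y| ≤ 6 * Real.sqrt (2 * Real.pi) * ν * (P.N j) * P.γ /
        Real.sqrt (P.δ j ^ 2 - 8 * Real.pi ^ 2 * ν * (P.N j : ℝ) ^ 2 * tHalf j)) ∧
      (∀ y, |deriv g y| ≤ 24 * Real.pi * Real.sqrt (2 * Real.pi) * ν * (P.N j : ℝ) ^ 2 * P.γ /
        (P.δ j ^ 2 - 8 * Real.pi ^ 2 * ν * (P.N j : ℝ) ^ 2 * tHalf j)) ∧
      (∀ c F : ℝ → ℝ → ℝ,
        ContDiffOn ℝ ∞ (Function.uncurry c) (Icc (tStart j) (tStart j + tHalf j) ×ˢ univ) →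
        (∀ t ∈ Icc (tStart j) (tStart j + tHalf j), Function.Periodic (c t) 1) →
        (∀ t ∈ Icc (tStart j) (tStart j + tHalf j), ∀ y,
          derivWithin (fun s => c s y) (Icc (tStart j) (tStart j + tHalf j)) t = ν * deriv (deriv (c t)) y) →
        c (tStart j) = g →
        ContDiffOn ℝ ∞ (Function.uncurry F) (Icc (tStart j) (tStart j + tHalf j) ×ˢ univ) →
        (∀ t ∈ Icc (tStart j) (tStart j + tHalf j), Function.Periodic (F t) 1) → F (tStart j) = (fun _ => 0) →
        (∀ t ∈ Icc (tStart j) (tStart j + tHalf j), ∀ y,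
          derivWithin (fun s => F s y) (Icc (tStart j) (tStart j + tHalf j)) t =
            ν * deriv (deriv (F t)) y + ν * (P.rateH j t * deriv (deriv (P.U j)) y)) →
        c (tStart j + tHalf j) = F (tStart j + tHalf j))) := by
    intro j
    by_cases hj : j ≤ J
    · obtain ⟨g, h1, h2, h3, h4, h5, h6⟩ := exists_realigned_lip_H P hδ₀ hd hγ (hN j) hν (hbud' j hj)
      exact ⟨g, fun _ => ⟨h1, h2, h3, h4, h5, h6⟩⟩
    · exact ⟨fun _ => 0, fun h => absurd h hj⟩
  have hexV : ∀ j : ℕ, ∃ g : ℝ → ℝ, j ≤ J → (ContDiff ℝ ∞ g ∧ Function.Periodic g 1 ∧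
      (∀ m : ℤ, (¬ ∃ n : ℤ, m = (2 * n + 1) * (P.N j : ℤ)) →
        fourierCoeff (AddCircle.liftIco 1 0 fun y => (g y : ℂ)) m = 0) ∧
      (∀ y, |g y| ≤ 6 * Real.sqrt (2 * Real.pi) * ν * (P.N j) * P.γ /
        Real.sqrt (P.δ j ^ 2 - 8 * Real.pi ^ 2 * ν * (P.N j : ℝ) ^ 2 * tHalf j)) ∧
      (∀ y, |deriv g y| ≤ 24 * Real.pi * Real.sqrt (2 * Real.pi) * ν * (P.N j : ℝ) ^ 2 * P.γ /
        (P.δ j ^ 2 - 8 * Real.pi ^ 2 * ν * (P.N j : ℝ) ^ 2 * tHalf j)) ∧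
      (∀ c F : ℝ → ℝ → ℝ,
        ContDiffOn ℝ ∞ (Function.uncurry c) (Icc (tStart j + tHalf j) (tStart (j + 1)) ×ˢ univ) →
        (∀ t ∈ Icc (tStart j + tHalf j) (tStart (j + 1)), Function.Periodic (c t) 1) →
        (∀ t ∈ Icc (tStart j + tHalf j) (tStart (j + 1)), ∀ y,
          derivWithin (fun s => c s y) (Icc (tStart j + tHalf j) (tStart (j + 1))) t = ν * deriv (deriv (c t)) y) →
        c (tStart j + tHalf j) = g →
        ContDiffOn ℝ ∞ (Function.uncurry F) (Icc (tStart j + tHalf j) (tStart (j + 1)) ×ˢ univ) →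
        (∀ t ∈ Icc (tStart j + tHalf j) (tStart (j + 1)), Function.Periodic (F t) 1) →
        F (tStart j + tHalf j) = (fun _ => 0) →
        (∀ t ∈ Icc (tStart j + tHalf j) (tStart (j + 1)), ∀ y,
          derivWithin (fun s => F s y) (Icc (tStart j + tHalf j) (tStart (j + 1))) t =
            ν * deriv (deriv (F t)) y + ν * (P.rateV j t * deriv (deriv (P.U j)) y)) →
        c (tStart (j + 1)) = F (tStart (j + 1)))) := by
    intro j
    by_cases hj : j ≤ J
    · obtain ⟨g, h1, h2, h3, h4, h5, h6⟩ := exists_realigned_lip_V P hδ₀ hd hγ (hN j) hν (hbud' j hj)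
      exact ⟨g, fun _ => ⟨h1, h2, h3, h4, h5, h6⟩⟩
    · exact ⟨fun _ => 0, fun h => absurd h hj⟩
  choose gH hgH using hexH
  choose gV hgV using hexV
  -- the slot-indexed profiles and sizes
  set g : ℕ → ℝ → ℝ := fun k => if k % 2 = 0 then gH (k / 2) else gV (k / 2) with hg_def
  set G₀ : ℕ → ℝ := fun k => 6 * Real.sqrt (2 * Real.pi) * ν * (P.N (k / 2)) * P.γ /
    Real.sqrt (P.δ (k / 2) ^ 2 - 8 * Real.pi ^ 2 * ν * (P.N (k / 2) : ℝ) ^ 2 * tHalf (k / 2)) with hG₀_def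
  set G₁ : ℕ → ℝ := fun k => 24 * Real.pi * Real.sqrt (2 * Real.pi) * ν * (P.N (k / 2) : ℝ) ^ 2 * P.γ /
    (P.δ (k / 2) ^ 2 - 8 * Real.pi ^ 2 * ν * (P.N (k / 2) : ℝ) ^ 2 * tHalf (k / 2)) with hG₁_def
  have hg_even : ∀ j, g (2 * j) = gH j := fun j => by
    simp only [hg_def, Nat.mul_mod_right, ↓reduceIte, show 2 * j / 2 = j by omega]
  have hg_odd : ∀ j, g (2 * j + 1) = gV j := fun j => by
    simp only [hg_def, show (2 * j + 1) % 2 = 1 by omega, one_ne_zero, ↓reduceIte, show (2 * j + 1) / 2 = j by omega]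
  have hkJ : ∀ {k : ℕ}, k < 2 * (J + 1) → k / 2 ≤ J := fun hk => by omega
  -- properties of `g k` for `k < 2(J+1)`
  have hgk : ∀ k < 2 * (J + 1), ContDiff ℝ ∞ (g k) ∧ Function.Periodic (g k) 1 ∧
      (∀ m : ℤ, (¬ ∃ n : ℤ, m = (2 * n + 1) * (P.N (k / 2) : ℤ)) →
        fourierCoeff (AddCircle.liftIco 1 0 fun y => (g k y : ℂ)) m = 0) ∧
      (∀ y, |g k y| ≤ G₀ k) ∧ (∀ y, |deriv (g k) y| ≤ G₁ k) := by
    intro k hk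
    obtain ⟨j, rfl | rfl⟩ := Nat.even_or_odd' k
    · obtain ⟨h1, h2, h3, h4, h5, -⟩ := hgH j (by omega)
      rw [hg_even]
      refine ⟨h1, h2, by simpa [show 2 * j / 2 = j by omega] using h3, fun y => ?_, fun y => ?_⟩
      · simp only [hG₀_def, show 2 * j / 2 = j by omega]
        exact h4 y
      · simp only [hG₁_def, show 2 * j / 2 = j by omega]
        exact h5 y
    · obtain ⟨h1, h2, h3, h4, h5, -⟩ := hgV j (by omega)
      rw [hg_odd]
      refine ⟨h1, h2, by simpa [show (2 * j + 1) / 2 = j by omega] using h3, fun y => ?_, fun y => ?_⟩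
      · simp only [hG₀_def, show (2 * j + 1) / 2 = j by omega]
        exact h4 y
      · simp only [hG₁_def, show (2 * j + 1) / 2 = j by omega]
        exact h5 y
  -- Step 2: the pieces `W k` (classical homogeneous solutions on `[σ k, T']` from the comb data)
  have hfield : Torus.IsSmoothSpaceTimeOn (Ico 0 1) P.field := cascadeFieldSmooth P hδ₀ hd
  have hexW : ∀ k : ℕ, ∃ (W : ℝ → UnitAddTorus (Fin 2) → EuclideanSpace ℝ (Fin 2)) (R : ℝ → UnitAddTorus (Fin 2) → ℝ),
      k < 2 * (J + 1) →
      (Torus.IsSmoothSpaceTimeOn (Icc (CascadeParams.tInject (k / 2) (k % 2 == 0)) T') W ∧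
       Torus.IsSmoothSpaceTimeOn (Icc (CascadeParams.tInject (k / 2) (k % 2 == 0)) T') R ∧
       (∀ t ∈ Icc (CascadeParams.tInject (k / 2) (k % 2 == 0)) T', Torus.IsDivFree (W t)) ∧
       (∀ t ∈ Icc (CascadeParams.tInject (k / 2) (k % 2 == 0)) T', ∀ x,
          Torus.timeDerivWithin (Icc (CascadeParams.tInject (k / 2) (k % 2 == 0)) T') W t x +
            Torus.convect (P.field t) (W t) x + Torus.convect (W t) (P.field t) x =
              ν • Torus.laplacian (W t) x - Torus.gradient (R t) x) ∧
       W (CascadeParams.tInject (k / 2) (k % 2 == 0)) =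
         (if k % 2 = 0 then fun x => g k (Torus.repr x 1) • EuclideanSpace.single (0 : Fin 2) (1 : ℝ)
          else fun x => g k (Torus.repr x 0) • EuclideanSpace.single (1 : Fin 2) (1 : ℝ))) := by
    intro k
    by_cases hk : k < 2 * (J + 1)
    · have hab : CascadeParams.tInject (k / 2) (k % 2 == 0) < T' := by
        have h1 : CascadeParams.tInject (k / 2) (k % 2 == 0) < CascadeParams.tInject ((k + 1) / 2) ((k + 1) % 2 == 0) :=
          slotStart_lt_succ k
        have h2 : CascadeParams.tInject ((k + 1) / 2) ((k + 1) % 2 == 0) ≤ tStart (J + 1) := by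
          rw [← slotStart_even (J + 1)]; exact slotStart_mono (by omega)
        linarith
      have hI : Icc (CascadeParams.tInject (k / 2) (k % 2 == 0)) T' ⊆ Ico (0 : ℝ) 1 := fun s hs =>
        ⟨(slotStart_nonneg k).trans hs.1, hs.2.trans_lt hT'1⟩
      have hu := hfield.mono hI
      have hudiv : ∀ s ∈ Icc (CascadeParams.tInject (k / 2) (k % 2 == 0)) T', Torus.IsDivFree (P.field s) :=
        fun s hs => DriftFreeExistence.isDivFree_field P (hI hs)
      obtain ⟨h1, h2, h3, -, -⟩ := hgk k hk
      by_cases hpar : k % 2 = 0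
      · obtain ⟨W, R, hW, hR, hWdiv, -, -, hWlin, hW0⟩ :=
          Torus.linearisedNS_exists hν hab hu hudiv (isSmooth_parallelShear (k := 1) (m := 0) h2 h1)
            (isDivFree_parallelShear (k := 1) (m := 0) (by decide) h2) (hasZeroMean_comb_H (hN _) h1 h2 h3)
        exact ⟨W, R, fun _ => ⟨hW, hR, hWdiv, hWlin, by rw [if_pos hpar]; exact hW0⟩⟩
      · obtain ⟨W, R, hW, hR, hWdiv, -, -, hWlin, hW0⟩ :=
          Torus.linearisedNS_exists hν hab hu hudiv (isSmooth_parallelShear (k := 0) (m := 1) h2 h1)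
            (isDivFree_parallelShear (k := 0) (m := 1) (by decide) h2) (hasZeroMean_comb_V (hN _) h1 h2 h3)
        exact ⟨W, R, fun _ => ⟨hW, hR, hWdiv, hWlin, by rw [if_neg hpar]; exact hW0⟩⟩
    · exact ⟨fun _ _ => 0, fun _ _ => 0, fun h => absurd h hk⟩
  choose W R hWR using hexW
  -- Step 3: the envelope
  have hW0H : ∀ j, 2 * j < 2 * (J + 1) → W (2 * j) (tStart j) =
      fun x => g (2 * j) (Torus.repr x 1) • EuclideanSpace.single (0 : Fin 2) (1 : ℝ) := by
    intro j hj
    have h := (hWR (2 * j) hj).2.2.2.2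
    rw [slotStart_even, if_pos (Nat.mul_mod_right 2 j)] at h
    exact h
  have hW0V : ∀ j, 2 * j + 1 < 2 * (J + 1) → W (2 * j + 1) (tStart j + tHalf j) =
      fun x => g (2 * j + 1) (Torus.repr x 0) • EuclideanSpace.single (1 : Fin 2) (1 : ℝ) := by
    intro j hj
    have h := (hWR (2 * j + 1) hj).2.2.2.2
    rw [slotStart_odd, if_neg (by omega : ¬ (2 * j + 1) % 2 = 0)] at h
    exact h
  have henv := response_phase_lip_envelope P (W := W) (g := g) (G₀ := G₀) (G₁ := G₁) hδ₀ hd hγ hN hν hLipν hJT hL hq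
    hLdiv hL0 hlin (fun k hk => ⟨(hgk k hk).1, (hgk k hk).2.1⟩) (fun k hk => (hgk k hk).2.2.1)
    (fun k hk => (hgk k hk).2.2.2.1) (fun k hk => (hgk k hk).2.2.2.2)
    (fun j hj => by rw [hg_even]; exact (hgH j (by omega)).2.2.2.2.2)
    (fun j hj => by rw [hg_odd]; exact (hgV j (by omega)).2.2.2.2.2)
    (R := R) (fun i hi => (hWR i hi).1) (fun i hi => (hWR i hi).2.1) (fun i hi => (hWR i hi).2.2.1)
    (fun i hi => (hWR i hi).2.2.2.1) hW0H hW0V hk ht x i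
  refine henv.trans (add_le_add (Finset.sum_le_sum fun l hl => ?_) (le_of_eq ?_))
  · have hl' : l < 2 * (J + 1) := (Finset.mem_range.1 hl).trans hk
    have hE : 0 ≤ G ^ (k / 2 + 1 - l / 2) := pow_nonneg hG _
    refine mul_le_mul_of_nonneg_left ?_ hE
    -- `G₁ l + (N/δ) G₀ l ≤ (48π√(2π) + 12√π) ν γ (N/δ)²` from `1/δ' ≤ √2/δ`, `1/δ'² ≤ 2/δ²`
    have hfac := (budget_facts (hδ (l / 2)) hν (tHalf_pos (l / 2)) (hN (l / 2)) (hbud (l / 2) (hkJ hl'))).2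
    have hfac2 := budget_facts_sq (hδ (l / 2)) hν (tHalf_pos (l / 2)) (hN (l / 2)) (hbud (l / 2) (hkJ hl'))
    have hN' : (0 : ℝ) ≤ (P.N (l / 2) : ℝ) := Nat.cast_nonneg _
    have hNδ : 0 ≤ (P.N (l / 2) : ℝ) / P.δ (l / 2) := div_nonneg hN' (hδ (l / 2)).le
    have hnum0 : 0 ≤ 6 * Real.sqrt (2 * Real.pi) * ν * (P.N (l / 2) : ℝ) * P.γ := by positivity
    have hnum1 : 0 ≤ 24 * Real.pi * Real.sqrt (2 * Real.pi) * ν * (P.N (l / 2) : ℝ) ^ 2 * P.γ := by positivity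
    have hG₀le : G₀ l ≤ 12 * Real.sqrt Real.pi * ν * P.γ * ((P.N (l / 2) : ℝ) / P.δ (l / 2)) := by
      simp only [hG₀_def]
      calc 6 * Real.sqrt (2 * Real.pi) * ν * (P.N (l / 2) : ℝ) * P.γ /
            Real.sqrt (P.δ (l / 2) ^ 2 - 8 * Real.pi ^ 2 * ν * (P.N (l / 2) : ℝ) ^ 2 * tHalf (l / 2))
          = 6 * Real.sqrt (2 * Real.pi) * ν * (P.N (l / 2) : ℝ) * P.γ *
              (1 / Real.sqrt (P.δ (l / 2) ^ 2 - 8 * Real.pi ^ 2 * ν * (P.N (l / 2) : ℝ) ^ 2 * tHalf (l / 2))) := by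
            ring
        _ ≤ 6 * Real.sqrt (2 * Real.pi) * ν * (P.N (l / 2) : ℝ) * P.γ * (Real.sqrt 2 / P.δ (l / 2)) :=
            mul_le_mul_of_nonneg_left hfac hnum0
        _ = 6 * (Real.sqrt 2 * Real.sqrt 2) * Real.sqrt Real.pi * ν * P.γ * ((P.N (l / 2) : ℝ) / P.δ (l / 2)) := by
            rw [Real.sqrt_mul (by norm_num : (0 : ℝ) ≤ 2)]
            ring
        _ = 12 * Real.sqrt Real.pi * ν * P.γ * ((P.N (l / 2) : ℝ) / P.δ (l / 2)) := by
            rw [Real.mul_self_sqrt (by norm_num : (0 : ℝ) ≤ 2)]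
            ring
    have hG₁le : G₁ l ≤ 48 * Real.pi * Real.sqrt (2 * Real.pi) * ν * P.γ * ((P.N (l / 2) : ℝ) / P.δ (l / 2)) ^ 2 := by
      simp only [hG₁_def]
      calc 24 * Real.pi * Real.sqrt (2 * Real.pi) * ν * (P.N (l / 2) : ℝ) ^ 2 * P.γ /
            (P.δ (l / 2) ^ 2 - 8 * Real.pi ^ 2 * ν * (P.N (l / 2) : ℝ) ^ 2 * tHalf (l / 2))
          = 24 * Real.pi * Real.sqrt (2 * Real.pi) * ν * (P.N (l / 2) : ℝ) ^ 2 * P.γ *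
              (1 / (P.δ (l / 2) ^ 2 - 8 * Real.pi ^ 2 * ν * (P.N (l / 2) : ℝ) ^ 2 * tHalf (l / 2))) := by ring
        _ ≤ 24 * Real.pi * Real.sqrt (2 * Real.pi) * ν * (P.N (l / 2) : ℝ) ^ 2 * P.γ * (2 / P.δ (l / 2) ^ 2) :=
            mul_le_mul_of_nonneg_left hfac2 hnum1
        _ = 48 * Real.pi * Real.sqrt (2 * Real.pi) * ν * P.γ * ((P.N (l / 2) : ℝ) / P.δ (l / 2)) ^ 2 := by
            have hδne : P.δ (l / 2) ≠ 0 := (hδ (l / 2)).ne'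
            field_simp
            ring
    have hN'δ : (P.N (l / 2) : ℝ) / P.δ (l / 2) * G₀ l ≤
        12 * Real.sqrt Real.pi * ν * P.γ * ((P.N (l / 2) : ℝ) / P.δ (l / 2)) ^ 2 := by
      calc (P.N (l / 2) : ℝ) / P.δ (l / 2) * G₀ l
          ≤ (P.N (l / 2) : ℝ) / P.δ (l / 2) * (12 * Real.sqrt Real.pi * ν * P.γ * ((P.N (l / 2) : ℝ) / P.δ (l / 2))) :=
            mul_le_mul_of_nonneg_left hG₀le hNδ
        _ = 12 * Real.sqrt Real.pi * ν * P.γ * ((P.N (l / 2) : ℝ) / P.δ (l / 2)) ^ 2 := by ring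
    calc G₁ l + (P.N (l / 2) : ℝ) / P.δ (l / 2) * G₀ l
        ≤ 48 * Real.pi * Real.sqrt (2 * Real.pi) * ν * P.γ * ((P.N (l / 2) : ℝ) / P.δ (l / 2)) ^ 2 +
            12 * Real.sqrt Real.pi * ν * P.γ * ((P.N (l / 2) : ℝ) / P.δ (l / 2)) ^ 2 := add_le_add hG₁le hN'δ
      _ = (48 * Real.pi * Real.sqrt (2 * Real.pi) + 12 * Real.sqrt Real.pi) * ν * P.γ *
            ((P.N (l / 2) : ℝ) / P.δ (l / 2)) ^ 2 := by ring
  · have hδne : P.δ (k / 2) ≠ 0 := (hδ (k / 2)).ne'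
    field_simp

end Assembly

end Summit.AnomalousDissipation.AnomalousDissipation.Theorems.SawtoothPulseCascade.ApproxResponse

end
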